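import Summits.Ventures.GridStability.Models.InverterDroopFaultOnFiltered
import Summits.Ventures.GridStability.Models.SMIBEnergyRoaGFM

/-!
# GridStability/Models/GFMSMIBCCTLower — a certified clearing time for the G3.a instance OF RECORD «GFM-SMIB-QoriaV4 (phys)»: every bolted terminal fault of duration ≤ 5.8 s is recovered (energy route ∘ closed-form fault-on arc, 0 kit)

Cell `gridfusion` (LADDER-GRIDFUSION rung G3.a, lever «G3.a-cct» of memo §3 fold #40; seat gridfusion-model-3
(g9)). The record of record `SMIB.gfmQoriaV4Phys` (= `InverterDroop.gfmSmibQoriaV4.toGridSMIB`, model-1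
`gfmQoriaV4Phys_eq_toGridSMIB`: `M = 113/3550`, `D = 3729/3550`, `P_m′ = 8290560/16581121`, `P_M = 4`,
`δˢ = arcsin(2072640/16581121)`; §III.4.2.2 couple `k_i = ω_b′/330`, `ω_c = 33` — P-INV-7: NOT the Chapter-V
converter) with model-1's certified energy well `6.4917 < V_cr` (`gfmQoriaV4Phys_energyWell_roa`,
SMIBEnergyRoaGFM.lean) and model-3's closed-form fault-on motion (`InverterDroopFaultOnFiltered.lean`): during a
bolted fault at the terminal the speed deviation is `Ω_F(T) = k_i p*′ (1 − e^{−33 T}) < k_i p*′ =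
9810496000/20610333403 ≈ 0.476 rad/s` and the angle `δ_F(T) < δˢ + k_i p*′ T` — with this record's droop
gain (`m_p = 0.003`) the fault-on drift is SLOW, so the energy well is left only after ≈ 6 s.
DECIDING THEOREM `gfmQoriaV4Phys_cct_lower`: for every `0 ≤ T ≤ 29/5` s and every solution `X` of
`gfmQoriaV4Phys` on `[0, ∞)` started at the fault-on state `X_F(T)`: the angle stays in the window, the energy
stays `≤ 6.4917`, and `X → (δˢ, 0)` — CCT(M) ≥ 5.8 s certified (inner estimate, damping ignored by the route).
THREE COLUMNS. CERTIFIED: the sentence about MODEL `gfmQoriaV4Phys` (MV-6D + MV-P + MV-Ω, bolted terminal fault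
`p_mes ≡ 0`, no limiter/VI). VALIDATED: NONE — by P-INV-7 the printed 350/498 ms belong to a different
converter (`m_p = 0.04`, `ω_c = 2.5`, VI active); the number 5.8 s only exhibits the record's small droop gain.
Nothing here says a converter is stable.
-/

noncomputable section

open Real Set Filter Topology
open Summit.Ventures.GridStability.Models.AngleEnclosure

namespace Summit.Ventures.GridStability.Models.SMIB

open InverterDroop

/-- `k_i p*′ = 9810496000/20610333403` (`≈ 0.476` rad/s) of the record of record. -/
def kpQV4 : ℝ := 9810496000 / 20610333403

/-- `k_i p*′` of the converter record equals `kpQV4`. -/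
theorem kpQV4_eq : gfmSmibQoriaV4.ki * gfmSmibQoriaV4.pref = kpQV4 := by
  norm_num [gfmSmibQoriaV4, kpQV4]

/-- The fault-on state of «GFM-SMIB-QoriaV4 (phys)» in SMIB coordinates after a bolted fault of duration
`T` from `(δˢ, 0)`: `(δˢ + k_i p*′ (T − (1 − e^{−33 T})/33), k_i p*′ (1 − e^{−33 T}))`. -/
def qv4FaultOnState (T : ℝ) : ℝ × ℝ :=
  (deltaQV4 + kpQV4 * (T - (1 - exp (-33 * T)) / 33), kpQV4 * (1 - exp (-33 * T)))

/-- The fault-on state IS model-3's closed-form fault-on motion of the converter record read through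
`toGridState`. -/
theorem qv4FaultOnState_eq (T : ℝ) :
    qv4FaultOnState T = gfmSmibQoriaV4.toGridState (gfmSmibQoriaV4.faultOnFiltered gfmSmibQoriaV4_δs T) := by
  rw [← deltaQV4_eq]
  simp only [qv4FaultOnState, ReducedParams.toGridState, ReducedParams.faultOnFiltered, gfmSmibQoriaV4,
    kpQV4, Prod.mk.injEq]
  constructor
  · norm_num
  · field_simp
    ring

/-- The potential part `g(δ) = −P_m′(δ − δˢ) − 4 cos δ` is non-decreasing on `[δˢ, π − δˢ]`. -/
theorem qv4_potential_monotoneOn :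
    MonotoneOn (fun δ => -(8290560 / 16581121 : ℝ) * (δ - deltaQV4) - 4 * cos δ)
      (Icc deltaQV4 (π - deltaQV4)) := by
  have hδs : deltaQV4 ∈ Icc (-(π / 2)) (π / 2) :=
    ⟨by linarith [deltaQV4_pos, pi_pos], deltaQV4_lt_pi_div_two.le⟩
  refine monotoneOn_of_deriv_nonneg (convex_Icc _ _) (by fun_prop) (by fun_prop) fun δ hδ => ?_
  rw [interior_Icc] at hδ
  have hsin : sin deltaQV4 < sin δ := ScalarFlow.sin_lt_sin_of_mem_window hδs hδ
  rw [sin_deltaQV4] at hsin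
  have hd : deriv (fun δ => -(8290560 / 16581121 : ℝ) * (δ - deltaQV4) - 4 * cos δ) δ
      = -(8290560 / 16581121 : ℝ) + 4 * sin δ := by
    have h1 : HasDerivAt (fun δ => -(8290560 / 16581121 : ℝ) * (δ - deltaQV4) - 4 * cos δ)
        (-(8290560 / 16581121 : ℝ) * 1 - 4 * (-sin δ)) δ :=
      (((hasDerivAt_id δ).sub_const deltaQV4).const_mul _).sub ((hasDerivAt_cos δ).const_mul 4)
    rw [h1.deriv]; ring
  rw [hd]
  norm_num [sQV4] at hsin ⊢
  linarith

/-- **Fault-on angle and energy at `T ≤ 29/5`.** The fault-on state has its angle in `[δˢ, 2.887]` and energy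
`≤ 6.4917` (crude bounds suffice: `Ω_F ≤ k_i p*′`, `δ_F ≤ δˢ + k_i p*′ T`). -/
theorem qv4FaultOnState_energy_le {T : ℝ} (hT0 : 0 ≤ T) (hT : T ≤ 29 / 5) :
    deltaQV4 ≤ (qv4FaultOnState T).1 ∧ (qv4FaultOnState T).1 ≤ 2887 / 1000 ∧
      gfmQoriaV4Phys.energy deltaQV4 (qv4FaultOnState T) ≤ 64917 / 10000 := by
  have hδs1 := deltaQV4_gt
  have hδs2 := deltaQV4_lt
  have hkp : (0 : ℝ) < kpQV4 := by norm_num [kpQV4]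
  have hE0 : 0 < exp (-33 * T) := exp_pos _
  have hE1 : exp (-33 * T) ≤ 1 := by rw [exp_le_one_iff]; nlinarith
  -- bracket: 0 ≤ T − (1 − e^{−33T})/33 ≤ T
  have hbr0 : 0 ≤ T - (1 - exp (-33 * T)) / 33 := by
    have := add_one_le_exp (-33 * T)
    rw [sub_nonneg, div_le_iff₀ (by norm_num : (0:ℝ) < 33)]
    linarith
  have hbr1 : T - (1 - exp (-33 * T)) / 33 ≤ T := by
    have : 0 ≤ (1 - exp (-33 * T)) / 33 := div_nonneg (by linarith) (by norm_num)
    linarith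
  have hang_lo : deltaQV4 ≤ (qv4FaultOnState T).1 := by
    simp only [qv4FaultOnState]; nlinarith
  have hang_hi : (qv4FaultOnState T).1 ≤ 2887 / 1000 := by
    simp only [qv4FaultOnState]
    have : kpQV4 * (T - (1 - exp (-33 * T)) / 33) ≤ kpQV4 * (29 / 5) :=
      mul_le_mul_of_nonneg_left (hbr1.trans hT) hkp.le
    norm_num [kpQV4] at this hδs2 ⊢
    nlinarith
  refine ⟨hang_lo, hang_hi, ?_⟩
  have hΩ0 : 0 ≤ (qv4FaultOnState T).2 := by
    simp only [qv4FaultOnState]; exact mul_nonneg hkp.le (by linarith)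
  have hΩ1 : (qv4FaultOnState T).2 ≤ kpQV4 := by
    simp only [qv4FaultOnState]; nlinarith
  have hwin_hi : (2887 / 1000 : ℝ) ≤ π - deltaQV4 := by linarith [pi_gt_d2]
  have hpot := qv4_potential_monotoneOn ⟨hang_lo, hang_hi.trans hwin_hi⟩ ⟨by linarith, hwin_hi⟩ hang_hi
  simp only at hpot
  have hcos : cosLower4 (2887 / 1000) ≤ cos (2887 / 1000 : ℝ) :=
    cosLower4_le_cos _ (by norm_num [dbl]) (by norm_num [dbl]) (by norm_num [dbl]) (by norm_num [dbl])
  norm_num [cosLower4, dbl] at hcos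
  simp only [energy, gfmQoriaV4Phys, sub_zero, cos_deltaQV4]
  norm_num [cQV4, kpQV4] at hΩ1 hpot ⊢
  nlinarith [hΩ0, hΩ1, hpot, hcos, sq_nonneg ((qv4FaultOnState T).2), hδs1, hδs2]

/-- **Certified clearing time ≥ 5.8 s for the MODEL of record «GFM-SMIB-QoriaV4 (phys)».** For every fault
duration `0 ≤ T ≤ 29/5` s: every solution of `gfmQoriaV4Phys` on `[0, ∞)` started at the closed-form fault-on
state `X_F(T)` keeps the angle window `(−π − δˢ, π − δˢ)` and energy `≤ 6.4917`, and tends to `(δˢ, 0)`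
(model-1's `gfmQoriaV4Phys_energyWell_roa` ∘ model-3's fault-on arc). MODELLED: MV-6D + MV-P + MV-Ω, `m_p =
0.003` (§III.4.2.2 couple) — P-INV-7: no printed comparator. -/
theorem gfmQoriaV4Phys_cct_lower {T : ℝ} (hT0 : 0 ≤ T) (hT : T ≤ 29 / 5) {X : ℝ → ℝ × ℝ}
    (hX : gfmQoriaV4Phys.IsSolutionOn X (Ici 0)) (h0 : X 0 = qv4FaultOnState T) :
    (∀ t, 0 ≤ t → (X t).1 ∈ Ioo (-π - deltaQV4) (π - deltaQV4) ∧
        gfmQoriaV4Phys.energy deltaQV4 (X t) ≤ 64917 / 10000) ∧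
      Tendsto X atTop (𝓝 (deltaQV4, 0)) := by
  obtain ⟨hlo, hhi, hE⟩ := qv4FaultOnState_energy_le hT0 hT
  refine gfmQoriaV4Phys_energyWell_roa hX ?_ ?_
  · rw [h0]
    constructor
    · linarith [deltaQV4_pos, pi_pos]
    · linarith [pi_gt_d2, deltaQV4_lt]
  · rw [h0]; exact hE

end Summit.Ventures.GridStability.Models.SMIB

end
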